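import Mathlib
import Literature.Analysis.FluidPDE.KNSSGradientBoundWindowEnd
import Literature.Analysis.FluidPDE.ClassicalBoundedUniformDerivativeBounds
import Literature.Analysis.FluidPDE.ElgindiBlowup
import Summits.NavierStokesRegularity.OSWSelfSimilar.TypeIIInnerLimitMasterDatum
import HarnessLib
/-!
# (C9)/(G4) — the GLOBAL two-scale reading: at every gauge time the gradient and the vorticity are bounded by a
# universal multiple of the velocity scale squared, over ALL of space (zone Z1 TEMPLATE §T1.3 (G4), §T1.4-III (C9),
# (K60) «the GLOBAL μ_ωu reading»; kernel, unconditional, any ν > 0)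

HONEST FRAMING (cell ns-blowup GROUP B «PROFILE SEARCH», zone Z1; D-0035/D-0074): part XXXVII of the Z1 dictionary. The
TEMPLATE's two-scale diagnostic is `μ_ωu(t) := ‖ω(t)‖_∞ / ‖u‖²_∞`; (C9) says it is bounded by an absolute constant at
running-maximum times, by local regularity of bounded mild solutions. Parts XXIX–XXXV carry the POINTWISE/LOCAL form of
this (the zoomed vorticity converges to `curl W`, `|curl W| ≤ C`); the census listed the GLOBAL form (sup over all `x`)
as NOT TYPED. It is typed here, from the tree's discharged KNSS 2009 (4.6) read at the end of the smoothing window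
(`exists_norm_fderiv_le_sq_of_isKNSSDriftMild`, `KNSSGradientBoundWindowEnd`) fed with the time-clamp of the classical
solution (`IsClassicalNSSolutionOn.isKNSSDriftMild_clamp_of_bounded`, `ClassicalBoundedUniformDerivativeBounds`); the
endpoint `t₀` of the gauge window is reached through the Lipschitz bound (mean value inequality on the open window,
continuity of `u` in time, `norm_fderiv_le_of_lip'`), so no time-continuity of `∇u` is needed:

* `exists_gaugeTime_fderiv_curl_bound` — universal `ε > 0`, `C ≥ 0`: for `u` classical (`ν = 1`, unforced) on
  `[0, T⋆) × ℝ³` with energy bounded on closed sub-slabs, a GAUGE TIME `t₀ ∈ (0, T⋆)` with scale `λ > 0`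
  (`λ‖u‖ ≤ 1` on `[0, t₀] × ℝ³`) and window `ελ² < t₀` has `λ²‖∇u(t₀, x)‖ ≤ C` and `λ²‖ω(t₀, x)‖ ≤ 4C` for ALL `x`;
* `eventually_gauge_fderiv_curl_bound` — along gauge N-a zoom data (`tₖ ≥ T⋆/2`, `λₖ → 0`) this holds for all large
  `k`: `μ_ωu(tₖ) = λₖ² sup_x ‖ω(tₖ, x)‖ ≤ 4C` — THE GLOBAL READING;
* `eventually_gauge_fderiv_curl_bound_viscosity` — the same at viscosity `ν > 0` for a maximal smooth Leray–Hopf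
  solution with the ν-covariant gauge `(λₖ/ν)‖u‖ ≤ 1`: `(λₖ²/ν)‖∇u(tₖ, x)‖ ≤ C`, `(λₖ²/ν)‖ω(tₖ, x)‖ ≤ 4C` — the
  normalisation of the zoomed vorticity in parts XXXIII/XXXV.

**Nothing here asserts that a singular solution exists.** «violates: n/a — dictionary; (K60) item 'GLOBAL μ_ωu reading'
discharged»; bears_on LADDER-NS N5/Z1 → N1 linear core / N0⁻ ((C9)/(G4)). Author: ns-blowup-profile-eng-1 g9,
2026-08-27.
-/

open Real Filter Topology Set MeasureTheory Function Metric
open scoped ENNReal NNReal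
open Literature.Analysis.FluidPDE

namespace Summit.NavierStokesRegularity.OSWSelfSimilar
namespace TypeIIModulationDictionary

section GaugeGradient

/-- **(C9)/(G4), GLOBAL FORM: AT A GAUGE TIME THE GRADIENT AND THE VORTICITY ARE `O(λ⁻²)` EVERYWHERE.** There are universal
`ε > 0`, `C ≥ 0` such that: for every classical solution `u` of Navier–Stokes (`ν = 1`, unforced) on `[0, T⋆) × ℝ³` whose
energy is bounded on every closed sub-slab, every `t₀ ∈ (0, T⋆)` and `λ > 0` with `λ‖u(t, x)‖ ≤ 1` on `[0, t₀] × ℝ³`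
(gauge N-a: `λ⁻¹` dominates the running supremum) and `ελ² < t₀` (the smoothing window fits), one has
`λ²‖∇u(t₀, x)‖ ≤ C` and `λ²‖curl u(t₀, x)‖ ≤ 4C` for ALL `x`. KNSS 2009 (4.6) at the window end on the time-clamp of `u`,
closed at `t₀` by the Lipschitz route (KNSS 2009 Prop. 4.1 with (4.6), `k = 1`, discharged in the tree as
`KNSS2009_prop41_mild_holds`). [new here — dictionary; unconditional] -/
theorem exists_gaugeTime_fderiv_curl_bound :
    ∃ ε : ℝ, 0 < ε ∧ ∃ C : ℝ, 0 ≤ C ∧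
      ∀ ⦃T : ℝ⦄ ⦃u : ℝ → EuclideanSpace ℝ (Fin 3) → EuclideanSpace ℝ (Fin 3)⦄ ⦃p : ℝ → EuclideanSpace ℝ (Fin 3) → ℝ⦄,
        IsClassicalNSSolutionOn (Ico 0 T) 1 0 u p →
        (∀ S < T, ∃ C' : ℝ≥0∞, C' < ⊤ ∧ ∀ t ∈ Icc 0 S, ∫⁻ x, ‖u t x‖ₑ ^ 2 ≤ C') →
        ∀ ⦃t₀ lam : ℝ⦄, 0 < t₀ → t₀ < T → 0 < lam → (∀ t ∈ Icc 0 t₀, ∀ x, lam * ‖u t x‖ ≤ 1) →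
          ε * lam ^ 2 < t₀ →
          ∀ x, lam ^ 2 * ‖fderiv ℝ (u t₀) x‖ ≤ C ∧ lam ^ 2 * ‖curl (u t₀) x‖ ≤ 4 * C := by
  obtain ⟨ε, hε, C, hC, H⟩ := exists_norm_fderiv_le_sq_of_isKNSSDriftMild
  refine ⟨ε, hε, C, hC, fun T u p hu hE t₀ lam ht₀ ht₀T hlam hgauge hwin => ?_⟩
  -- ### the time-clamp of `u` on `[0, t₀]` is a restarted bounded mild field with bound `N = λ⁻¹`
  set N : ℝ := lam⁻¹ with hN
  have hN0 : 0 < N := inv_pos.2 hlam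
  have hu' : IsClassicalNSSolutionOn (Icc 0 t₀) 1 0 u p :=
    hu.mono (Icc_subset_Ico_right ht₀T) (uniqueDiffOn_Icc ht₀)
  have hE' : ∃ C' : ℝ≥0∞, C' < ⊤ ∧ ∀ t ∈ Icc 0 t₀, ∫⁻ x, ‖u t x‖ₑ ^ 2 ≤ C' := hE t₀ ht₀T
  have hbd : ∀ t ∈ Icc 0 t₀, ∀ x, ‖u t x‖ ≤ N := fun t ht x => by
    have h := hgauge t ht x
    rw [hN, inv_eq_one_div, le_div_iff₀ hlam, mul_comm]
    exact h
  have hV := hu'.isKNSSDriftMild_clamp_of_bounded ht₀ hE' hN0 hbd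
  have hεl : 0 < ε * lam ^ 2 := by positivity
  -- ### KNSS (4.6) at the window end, on the open window `(ελ², t₀)`
  have hgrad : ∀ t ∈ Ioo (ε * lam ^ 2) t₀, ∀ x, ‖fderiv ℝ (u t) x‖ ≤ C * N ^ 2 := by
    intro t ht x
    have ht0 : 0 < t := hεl.trans ht.1
    have hNt : ε ≤ N ^ 2 * t := by
      have h1 : ε * lam ^ 2 ≤ t := ht.1.le
      have hl2 : 0 < lam ^ 2 := by positivity
      calc ε = ε * lam ^ 2 * (lam ^ 2)⁻¹ := by field_simp
        _ ≤ t * (lam ^ 2)⁻¹ := by gcongr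
        _ = N ^ 2 * t := by rw [hN, inv_pow]; ring
    have h := H hV t ⟨ht0, ht.2⟩ hNt x
    simp only [min_eq_left ht.2.le, max_eq_right ht0.le] at h
    exact h
  -- ### Lipschitz bound on the open window (mean value inequality), passed to `t₀` by continuity in time
  have hlipt : ∀ t ∈ Ioo (ε * lam ^ 2) t₀, ∀ x y : EuclideanSpace ℝ (Fin 3),
      ‖u t y - u t x‖ ≤ C * N ^ 2 * ‖y - x‖ := by
    intro t ht x y
    have htI : t ∈ Ico 0 T := ⟨(hεl.trans ht.1).le, ht.2.trans ht₀T⟩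
    have hdiff : ∀ z ∈ (univ : Set (EuclideanSpace ℝ (Fin 3))), DifferentiableAt ℝ (u t) z := fun z _ =>
      ((hu.contDiff_velocity htI).differentiable (by simp)).differentiableAt
    exact Convex.norm_image_sub_le_of_norm_fderiv_le hdiff (fun z _ => hgrad t ht z) convex_univ (mem_univ x)
      (mem_univ y)
  have hcont : ∀ z : EuclideanSpace ℝ (Fin 3), Tendsto (fun t => u t z) (𝓝[<] t₀) (𝓝 (u t₀ z)) := by
    intro z
    have h1 : ContinuousWithinAt (uncurry u) (Ico 0 T ×ˢ univ) (t₀, z) :=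
      hu.smooth_velocity.continuousOn _ ⟨⟨ht₀.le, ht₀T⟩, mem_univ _⟩
    have h2 : Tendsto (fun t : ℝ => (t, z)) (𝓝[<] t₀) (𝓝[Ico 0 T ×ˢ univ] (t₀, z)) := by
      apply tendsto_nhdsWithin_of_tendsto_nhds_of_eventually_within
      · exact ((continuous_id.prodMk continuous_const).tendsto t₀).mono_left nhdsWithin_le_nhds
      · filter_upwards [Ioo_mem_nhdsLT ht₀] with t ht
        exact ⟨⟨ht.1.le, ht.2.trans ht₀T⟩, mem_univ _⟩
    exact h1.tendsto.comp h2
  have hlip0 : ∀ x y : EuclideanSpace ℝ (Fin 3), ‖u t₀ y - u t₀ x‖ ≤ C * N ^ 2 * ‖y - x‖ := by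
    intro x y
    have hlim : Tendsto (fun t => ‖u t y - u t x‖) (𝓝[<] t₀) (𝓝 ‖u t₀ y - u t₀ x‖) :=
      ((hcont y).sub (hcont x)).norm
    refine le_of_tendsto hlim ?_
    filter_upwards [Ioo_mem_nhdsLT hwin] with t ht
    exact hlipt t ht x y
  -- ### the gradient at `t₀` from the Lipschitz bound
  have hgrad0 : ∀ x, ‖fderiv ℝ (u t₀) x‖ ≤ C * N ^ 2 := fun x =>
    norm_fderiv_le_of_lip' ℝ (by positivity) (Eventually.of_forall fun y => hlip0 x y)
  intro x
  have h1 : lam ^ 2 * ‖fderiv ℝ (u t₀) x‖ ≤ C := by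
    have hlamN : lam ^ 2 * (C * N ^ 2) = C := by
      rw [hN]
      field_simp
    calc lam ^ 2 * ‖fderiv ℝ (u t₀) x‖ ≤ lam ^ 2 * (C * N ^ 2) := by gcongr; exact hgrad0 x
      _ = C := hlamN
  refine ⟨h1, ?_⟩
  calc lam ^ 2 * ‖curl (u t₀) x‖ ≤ lam ^ 2 * (4 * ‖fderiv ℝ (u t₀) x‖) := by
        gcongr
        exact norm_curl_le_four_mul _ _
    _ = 4 * (lam ^ 2 * ‖fderiv ℝ (u t₀) x‖) := by ring
    _ ≤ 4 * C := by gcongr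

/-- **THE GLOBAL μ_ωu READING ALONG GAUGE N-a ZOOM DATA.** Universal `C ≥ 0`: for `u` classical (`ν = 1`, unforced) on
`[0, T⋆) × ℝ³`, `T⋆ > 0`, with energy bounded on closed sub-slabs, and gauge data `tₖ ∈ [T⋆/2, T⋆)`, `λₖ > 0 → 0`,
`λₖ‖u‖ ≤ 1` on `[0, tₖ] × ℝ³` (as produced by parts XXII/XXXII/XXXIV), for all large `k` and ALL `x`:
`λₖ²‖∇u(tₖ, x)‖ ≤ C` and `λₖ²‖ω(tₖ, x)‖ ≤ 4C` — the vorticity never exceeds a universal multiple of the velocity scale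
squared ANYWHERE at the gauge times. [new here — dictionary; unconditional] -/
theorem eventually_gauge_fderiv_curl_bound :
    ∃ C : ℝ, 0 ≤ C ∧
      ∀ ⦃T : ℝ⦄ ⦃u : ℝ → EuclideanSpace ℝ (Fin 3) → EuclideanSpace ℝ (Fin 3)⦄ ⦃p : ℝ → EuclideanSpace ℝ (Fin 3) → ℝ⦄,
        IsClassicalNSSolutionOn (Ico 0 T) 1 0 u p →
        (∀ S < T, ∃ C' : ℝ≥0∞, C' < ⊤ ∧ ∀ t ∈ Icc 0 S, ∫⁻ x, ‖u t x‖ₑ ^ 2 ≤ C') →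
        ∀ ⦃tn lamn : ℕ → ℝ⦄, 0 < T → (∀ k, T / 2 ≤ tn k ∧ tn k < T) → (∀ k, 0 < lamn k) →
          Tendsto lamn atTop (𝓝 0) → (∀ k, ∀ t ∈ Icc 0 (tn k), ∀ x, lamn k * ‖u t x‖ ≤ 1) →
          ∀ᶠ k in atTop, ∀ x, lamn k ^ 2 * ‖fderiv ℝ (u (tn k)) x‖ ≤ C ∧
            lamn k ^ 2 * ‖curl (u (tn k)) x‖ ≤ 4 * C := by
  obtain ⟨ε, hε, C, hC, H⟩ := exists_gaugeTime_fderiv_curl_bound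
  refine ⟨C, hC, fun T u p hu hE tn lamn hT htn hlam hlam0 hgauge => ?_⟩
  have h1 : Tendsto (fun k => ε * lamn k ^ 2) atTop (𝓝 0) := by
    simpa using (hlam0.pow 2).const_mul ε
  filter_upwards [h1.eventually (gt_mem_nhds (by positivity : (0 : ℝ) < T / 2))] with k hk x
  exact H hu hE (lt_of_lt_of_le (by positivity) (htn k).1) (htn k).2 (hlam k) (hgauge k) (hk.trans_le (htn k).1) x

/-- **THE GLOBAL μ_ωu READING AT VISCOSITY ν > 0.** Universal `C ≥ 0`: for a maximal smooth unforced solution at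
viscosity `ν` (`IsMaximalSmoothSolution ν 0 u p T⋆`, `T⋆ > 0`), Leray–Hopf from `u 0`, with ν-covariant gauge data
`tₖ ∈ [T⋆/2, T⋆)`, `λₖ > 0 → 0`, `(λₖ/ν)‖u‖ ≤ 1` on `[0, tₖ] × ℝ³` (parts XXXIII/XXXV/XXXVI), for all large `k` and ALL
`x`: `(λₖ²/ν)‖∇u(tₖ, x)‖ ≤ C` and `(λₖ²/ν)‖ω(tₖ, x)‖ ≤ 4C` — the normalisation of the zoomed vorticity of the master
theorems. Part of `v = ν⁻¹u(ν⁻¹ ·)`. [new here — dictionary; unconditional, any ν > 0] -/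
theorem eventually_gauge_fderiv_curl_bound_viscosity :
    ∃ C : ℝ, 0 ≤ C ∧
      ∀ ⦃ν T : ℝ⦄ ⦃u : ℝ → EuclideanSpace ℝ (Fin 3) → EuclideanSpace ℝ (Fin 3)⦄ ⦃p : ℝ → EuclideanSpace ℝ (Fin 3) → ℝ⦄,
        0 < ν → 0 < T → IsMaximalSmoothSolution ν 0 u p T → IsLerayHopfOn T ν 0 (u 0) u →
        ∀ ⦃tn lamn : ℕ → ℝ⦄, (∀ k, T / 2 ≤ tn k ∧ tn k < T) → (∀ k, 0 < lamn k) → Tendsto lamn atTop (𝓝 0) →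
          (∀ k, ∀ t ∈ Icc 0 (tn k), ∀ x, lamn k / ν * ‖u t x‖ ≤ 1) →
          ∀ᶠ k in atTop, ∀ x, lamn k ^ 2 / ν * ‖fderiv ℝ (u (tn k)) x‖ ≤ C ∧
            lamn k ^ 2 / ν * ‖curl (u (tn k)) x‖ ≤ 4 * C := by
  obtain ⟨C, hC, H⟩ := eventually_gauge_fderiv_curl_bound
  refine ⟨C, hC, fun ν T u p hν hT hmax hLH tn lamn htn hlam hlam0 hgauge => ?_⟩
  set v : ℝ → EuclideanSpace ℝ (Fin 3) → EuclideanSpace ℝ (Fin 3) := timeRescale ν⁻¹ ν⁻¹ u with hv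
  have hνT : 0 < ν * T := mul_pos hν hT
  have hmax' : IsMaximalSmoothSolution 1 0 v (timeRescale ν⁻¹ (ν⁻¹ ^ 2) p) (ν * T) := hmax.toUnitViscosity hν
  have hv0 : v 0 = ν⁻¹ • u 0 := by
    funext x
    simp [hv, timeRescale_apply]
  have hLH' : IsLerayHopfOn (ν * T) 1 0 (v 0) v := by
    have h := hLH.viscosityRescale (inv_pos.2 hν)
    rw [inv_mul_cancel₀ hν.ne', timeRescale_zero_force, div_inv_eq_mul, mul_comm T ν] at h
    rwa [hv0]
  have hEv := energyBound_of_lerayHopf hLH'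
  -- gauge data for `v`: times `ν tₖ`, same scales
  have htn' : ∀ k, ν * T / 2 ≤ ν * tn k ∧ ν * tn k < ν * T := fun k =>
    ⟨by nlinarith [(htn k).1, hν], mul_lt_mul_of_pos_left (htn k).2 hν⟩
  have hgauge' : ∀ k, ∀ t ∈ Icc 0 (ν * tn k), ∀ x, lamn k * ‖v t x‖ ≤ 1 := fun k t ht x => by
    rw [hv, timeRescale_apply, norm_smul, Real.norm_eq_abs, abs_of_pos (inv_pos.2 hν)]
    have hνt : ν⁻¹ * t ∈ Icc 0 (tn k) :=
      ⟨mul_nonneg (inv_pos.2 hν).le ht.1, by rw [inv_mul_le_iff₀ hν]; exact ht.2⟩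
    have h := hgauge k (ν⁻¹ * t) hνt x
    calc lamn k * (ν⁻¹ * ‖u (ν⁻¹ * t) x‖) = lamn k / ν * ‖u (ν⁻¹ * t) x‖ := by ring
      _ ≤ 1 := h
  have h := H hmax'.1 hEv hνT htn' hlam hlam0 hgauge'
  filter_upwards [h] with k hk x
  obtain ⟨h1, h2⟩ := hk x
  have ht0 : tn k ∈ Ico 0 T := ⟨le_trans (by positivity) (htn k).1, (htn k).2⟩
  have hslice : v (ν * tn k) = fun y => ν⁻¹ • u (tn k) y := by
    funext y
    rw [hv, timeRescale_apply, ← mul_assoc, inv_mul_cancel₀ hν.ne', one_mul]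
  have hdiff : DifferentiableAt ℝ (u (tn k)) x :=
    ((hmax.1.contDiff_velocity ht0).differentiable (by simp)).differentiableAt
  have hfd : fderiv ℝ (v (ν * tn k)) x = ν⁻¹ • fderiv ℝ (u (tn k)) x := by
    rw [hslice]
    exact fderiv_const_smul hdiff ν⁻¹
  have hcurl : curl (v (ν * tn k)) x = ν⁻¹ • curl (u (tn k)) x := by
    rw [hslice, curl_const_smul_noDiff]
  rw [hfd, norm_smul, Real.norm_eq_abs, abs_of_pos (inv_pos.2 hν)] at h1
  rw [hcurl, norm_smul, Real.norm_eq_abs, abs_of_pos (inv_pos.2 hν)] at h2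
  constructor
  · calc lamn k ^ 2 / ν * ‖fderiv ℝ (u (tn k)) x‖ = lamn k ^ 2 * (ν⁻¹ * ‖fderiv ℝ (u (tn k)) x‖) := by ring
      _ ≤ C := h1
  · calc lamn k ^ 2 / ν * ‖curl (u (tn k)) x‖ = lamn k ^ 2 * (ν⁻¹ * ‖curl (u (tn k)) x‖) := by ring
      _ ≤ 4 * C := h2

end GaugeGradient

end TypeIIModulationDictionary
end Summit.NavierStokesRegularity.OSWSelfSimilar
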